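import Literature.Computability.Cryptography.SamplingProblems
import HarnessLib

/-!
# Sampling problems — discharged facts (BosonSampling normalisation)

Proofs of named facts stated in `Literature.Computability.Cryptography.SamplingProblems` (kept in
a sibling file so that the statement file stays a definitions/named-facts file):

* `sum_norm_sq_permanent_submatrix`: for a column-orthonormal `m × n` matrix `A`
  (`Aᴴ A = 1`), `∑_{s : Fin n → Fin m} |Per(A_s)|² = n!`, where `A_s` is the `n × n` matrix with
  rows `A_{s 0}, …, A_{s (n-1)}`. This is Aaronson–Arkhipov's normalisation
  `∑_S |Per(A_S)|²/(s₁! ⋯ s_m!) = 1` (Thm. 3.10 and its footnote: `φ(U)` is unitary, so the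
  probabilities (3.53) sum to one) rewritten over *ordered* mode assignments; the proof given
  here is the direct expansion
  `∑_s Per(A_s)^* Per(A_s) = ∑_{σ,τ} ∏_i (AᴴA)_{τ i, σ i} = ∑_{σ,τ} [σ = τ] = n!`
  (expand both permanents, exchange the sums, factor the sum over `s` coordinatewise with
  `Fintype.prod_sum`, and use `AᴴA = 1`).
* `sum_bosonWeight_eq_one_holds` discharges `sum_bosonWeight_eq_one` (divide by `n!`); the
  hypothesis `n ≤ m` of the named fact is not needed (it follows from `Aᴴ A = 1` anyway).
* `bosonSamplingPMF_apply_holds` discharges `bosonSamplingPMF_apply`: the amplitude vector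
  `s ↦ Per(A_s)/√(n!)` is a unit vector, so `bornPMF` performs no normalisation
  (`bornPMF_apply_of_sum_eq_one`).

## References

* S. Aaronson, A. Arkhipov, *The computational complexity of linear optics*, Theory of
  Computing 9 (2013) 143–252, doi:10.4086/toc.2013.v009a004: §3.1, Def. of `φ(A)` eq. (3.32)
  and Thm. 3.10 (`φ(U)` is the unitary `n`-boson representation, PDF pp. 26–29); §3 eq. (3.53)
  and footnote (the probabilities `|Per(U_{S,T})|²/(s₁!⋯s_m! t₁!⋯t_n!)` sum to one), PDF p. 30;
  §1.1 eq. (1.3).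
-/

namespace Literature.Computability.Cryptography

open Matrix _root_.Computability Complexity
open scoped ComplexConjugate

variable {m n : ℕ}

/-! ### The normalisation identity -/

/-- The permanent of the row-selection `A_s` in "row-major" form:
`Per(A_s) = ∑_σ ∏_i A (s i) (σ i)` (transpose Mathlib's column-major definition). [folklore] -/
theorem permanent_submatrix_eq_sum (A : Matrix (Fin m) (Fin n) ℂ) (s : Fin n → Fin m) :
    (A.submatrix s id).permanent = ∑ σ : Equiv.Perm (Fin n), ∏ i, A (s i) (σ i) := by
  rw [← Matrix.permanent_transpose]
  rfl

/-- **Normalisation of BosonSampling over ordered outcomes.** For a column-orthonormal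
`m × n` matrix `A` (`Aᴴ A = 1`), `∑_{s : Fin n → Fin m} |Per(A_s)|² = n!`. Grouping the `n!/∏ sⱼ!`
orderings of each multiset `S` this is Aaronson–Arkhipov's `∑_S |Per(A_S)|²/(s₁!⋯s_m!) = 1`
(unitarity of `φ(U)`, Thm. 3.10, applied to the column `|1_n⟩`). Direct proof: expand both
permanents, exchange sums, factor the sum over `s` coordinatewise (`Fintype.prod_sum`) into
`∏_i (AᴴA)_{τ i, σ i} = [σ = τ]`. (Aaronson–Arkhipov 2013, Thm. 3.10 and eq. (3.53) with its
footnote, PDF pp. 29–30.) [cite: AaronsonArkhipovToC2013, Thm. 3.10 and eq. (3.53) footnote] -/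
theorem sum_norm_sq_permanent_submatrix {A : Matrix (Fin m) (Fin n) ℂ}
    (hA : IsColumnOrthonormal A) :
    ∑ s : Fin n → Fin m, ‖(A.submatrix s id).permanent‖ ^ 2 = (n.factorial : ℝ) := by
  -- the entries of `Aᴴ A = 1`
  have hentry : ∀ j k : Fin n, ∑ r : Fin m, conj (A r j) * A r k = if j = k then 1 else 0 := by
    intro j k
    have h := congrFun (congrFun hA j) k
    rw [Matrix.mul_apply, Matrix.one_apply] at h
    simpa [Matrix.conjTranspose_apply] using h
  -- the identity in `ℂ`
  have key : ∑ s : Fin n → Fin m,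
      conj ((A.submatrix s id).permanent) * (A.submatrix s id).permanent = (n.factorial : ℂ) := by
    calc ∑ s : Fin n → Fin m, conj ((A.submatrix s id).permanent) * (A.submatrix s id).permanent
        = ∑ s : Fin n → Fin m, ∑ τ : Equiv.Perm (Fin n), ∑ σ : Equiv.Perm (Fin n),
            ∏ i, conj (A (s i) (τ i)) * A (s i) (σ i) := by
          refine Finset.sum_congr rfl fun s _ => ?_
          rw [permanent_submatrix_eq_sum, map_sum, Finset.sum_mul_sum]
          refine Finset.sum_congr rfl fun τ _ => Finset.sum_congr rfl fun σ _ => ?_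
          rw [map_prod, ← Finset.prod_mul_distrib]
      _ = ∑ τ : Equiv.Perm (Fin n), ∑ σ : Equiv.Perm (Fin n), ∑ s : Fin n → Fin m,
            ∏ i, conj (A (s i) (τ i)) * A (s i) (σ i) := by
          rw [Finset.sum_comm]
          exact Finset.sum_congr rfl fun τ _ => Finset.sum_comm
      _ = ∑ τ : Equiv.Perm (Fin n), ∑ σ : Equiv.Perm (Fin n),
            ∏ i, ∑ r : Fin m, conj (A r (τ i)) * A r (σ i) := by
          refine Finset.sum_congr rfl fun τ _ => Finset.sum_congr rfl fun σ _ => ?_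
          exact (Fintype.prod_sum fun i r => conj (A r (τ i)) * A r (σ i)).symm
      _ = ∑ τ : Equiv.Perm (Fin n), ∑ σ : Equiv.Perm (Fin n), if τ = σ then 1 else 0 := by
          refine Finset.sum_congr rfl fun τ _ => Finset.sum_congr rfl fun σ _ => ?_
          simp_rw [hentry]
          rw [Fintype.prod_boole]
          congr 1
          rw [eq_iff_iff, Equiv.ext_iff]
      _ = (n.factorial : ℂ) := by
          simp only [Finset.sum_ite_eq, Finset.mem_univ, if_true, Finset.sum_const,
            Finset.card_univ, Fintype.card_perm, Fintype.card_fin, nsmul_eq_mul, mul_one]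
  -- back to `ℝ`
  apply Complex.ofReal_injective
  push_cast
  rw [← key]
  refine Finset.sum_congr rfl fun s _ => ?_
  rw [Complex.conj_mul']

/-- **Discharge of `sum_bosonWeight_eq_one`.** For column-orthonormal `A` the BosonSampling
weights `|Per(A_s)|²/n!` sum to `1` over ordered mode assignments (`sum_norm_sq_permanent_submatrix`
divided by `n!`; the hypothesis `n ≤ m` is not used). (Aaronson–Arkhipov 2013, Thm. 3.10 and
eq. (3.53) footnote, PDF pp. 29–30.) [cite: AaronsonArkhipovToC2013, Thm. 3.10 and eq. (3.53) footnote] -/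
theorem sum_bosonWeight_eq_one_holds : sum_bosonWeight_eq_one (m := m) (n := n) := by
  intro A hA _
  unfold bosonWeight
  rw [← Finset.sum_div, sum_norm_sq_permanent_submatrix hA, div_self]
  exact_mod_cast n.factorial_ne_zero

/-- The BosonSampling amplitude vector `s ↦ Per(A_s)/√(n!)` of a column-orthonormal `A` is a unit
vector: `∑_s |Per(A_s)/√(n!)|² = 1`. (Aaronson–Arkhipov 2013, Thm. 3.10, PDF p. 29.) [cite: AaronsonArkhipovToC2013, Thm. 3.10] -/
theorem sum_norm_sq_bosonAmplitude_eq_one {A : Matrix (Fin m) (Fin n) ℂ}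
    (hA : IsColumnOrthonormal A) :
    ∑ s : Fin n → Fin m,
      ‖(A.submatrix s id).permanent / (Real.sqrt n.factorial : ℂ)‖ ^ 2 = 1 := by
  have hfac : (0 : ℝ) < n.factorial := by exact_mod_cast n.factorial_pos
  have hterm : ∀ s : Fin n → Fin m,
      ‖(A.submatrix s id).permanent / (Real.sqrt n.factorial : ℂ)‖ ^ 2 =
        ‖(A.submatrix s id).permanent‖ ^ 2 / n.factorial := by
    intro s
    rw [norm_div, div_pow, Complex.norm_real, Real.norm_of_nonneg (Real.sqrt_nonneg _),
      Real.sq_sqrt hfac.le]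
  simp_rw [hterm]
  rw [← Finset.sum_div, sum_norm_sq_permanent_submatrix hA, div_self hfac.ne']

/-- **Discharge of `bosonSamplingPMF_apply`.** For column-orthonormal `A` the BosonSampling
distribution assigns to the ordered outcome `s` exactly `|Per(A_s)|²/n!`: the amplitude vector is
a unit vector (`sum_norm_sq_bosonAmplitude_eq_one`), so `bornPMF` does not renormalise
(`bornPMF_apply_of_sum_eq_one`). (Aaronson–Arkhipov 2013, §1.1 eq. (1.3) and Thm. 3.10, PDF
pp. 4, 29.) [cite: AaronsonArkhipovToC2013, eq. (1.3) and Thm. 3.10] -/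
theorem bosonSamplingPMF_apply_holds : bosonSamplingPMF_apply (m := m) (n := n) := by
  intro _ A hA _ s
  have hfac : (0 : ℝ) < n.factorial := by exact_mod_cast n.factorial_pos
  unfold bosonSamplingPMF
  rw [bornPMF_apply_of_sum_eq_one (sum_norm_sq_bosonAmplitude_eq_one hA) s, bosonWeight,
    norm_div, div_pow, Complex.norm_real, Real.norm_of_nonneg (Real.sqrt_nonneg _),
    Real.sq_sqrt hfac.le]

end Literature.Computability.Cryptography
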